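import Literature.NumberTheory.LFunctions.BondarenkoHeap2026Sections3to5
import Literature.NumberTheory.LFunctions.PrimitiveQuadraticCharacterGaussSum
import Literature.NumberTheory.LFunctions.PrimitiveQuadraticCharacter
import Literature.NumberTheory.LFunctions.KloostermanQuadraticTwist
import Literature.NumberTheory.Sieve.LargeSieveCharacters
import HarnessLib

/-!
# Bondarenko–Heap 2026, (14): the local layer — CRT multiplicativity and the sums at odd primes

LABEL (C5 / rh-crit-ah, LADDER-RH §4 HELD «conditional bridges: exceptional zero ⇒ …»):
**NOT RH-BEARING.** RH-FREE literature: complete character sums modulo `q`; no `ζ`, no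
`RiemannHypothesis`; nothing here bears on the truth of RH.

Towards the discharge of the named fact `eq14` of `BondarenkoHeap2026Sections3to5` (arXiv:2608.07399v1,
§4 (14), p. 11: "By the Chinese remainder theorem and the explicit evaluation of Gauss sums,
`S_q(k, r; 0) ≪ q^ε (r, Q)`, `S_q(k, r; b) ≪ q^{1/2+ε} (r, b, Q)^{1/2}` (`b ≢ 0`); when `(r, Q) = 1` the
complete sums exhibit square-root cancellation; in general the cancellation is lost only at primes
`p ∣ (r, Q)`"), this file PROVES the two local ingredients:

* `twistedShiftSum_eq_mul_of_coprime` — **CRT multiplicativity** of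
  `S_q(k, r; c) = Σ_{a mod q} χ(a)χ(ak + r)e(−ac/q)` across coprime moduli, with the additive twist
  split by the tree's `PrimitiveQuadratic.stdAddChar_chineseRemainder_symm`
  (`e(x/(q₁q₂)) = e(q̄₂u/q₁)e(q̄₁v/q₂)`): `S_{q₁q₂}(k,r;c) = S_{q₁}(k,r;c q̄₂) · S_{q₂}(k,r;c q̄₁)`.
* **The sums at an odd prime `p`** for the quadratic character `χ ≠ 1` (= the Legendre symbol, tree
  `PrimitiveQuadratic.eq_quadraticChar_of_isQuadratic`), in the three cases of the printed evaluation: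
  `p ∣ k`: `S_p = χ(r)·(Gauss sum)`, so `S_p = 0` if `c = 0` and `|S_p| ≤ √p` otherwise
  (`norm_twistedShiftSum_prime_of_dvd`, tree `Sieve.LargeSieve.norm_gaussSum_sq`);
  `p ∤ k`, `p ∣ r`: `S_p = χ(k)(p·1_{c=0} − 1)`, so `|S_p| ≤ p` resp. `≤ 1`
  (`norm_twistedShiftSum_prime_of_dvd_r`);
  `p ∤ kr`: `S_p = χ(k) Σ_a χ(a(a − t)) e(−ac/p)`, `t = −r k̄ ≠ 0`, which is `−χ(k)` for `c = 0`
  (Jacobsthal, tree `sum_quadraticChar_mul_sub_eq_neg_one`) and a unimodular multiple of the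
  Kloosterman sum `K(1, (ct/4)²; p)` otherwise (tree `sum_quadraticChar_mul_sub_mul_stdAddChar`),
  whence `|S_p| ≤ 2√p` by **Weil's bound, PROVED in the tree** (`weil_kloosterman_bound_prime_holds`,
  Stepanov's method) — `norm_twistedShiftSum_prime_of_not_dvd`.

What remains for `eq14_holds` (NOT done here): the induction over the prime factorisation of the odd
squarefree part `Q` (`modulus_eq_two_pow_mul_odd_squarefree`, (11)), the trivial bound `|S_{2^ν}| ≤ 8`
(`ν ≤ 3`), `Π_{p ∣ Q, p ∣ r} p = (r, Q)` for squarefree `Q`, and `2^{ω(Q)} ≤ d(Q) ≪ q^ε`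
(tree `Sieve.exists_card_divisors_le_mul_rpow`).

## References

* [BondarenkoHeap2026] A. Bondarenko, W. Heap, arXiv:2608.07399v1, §4, proof of Lemma 4 and (14), p. 11.
* [Iwaniec2002] H. Iwaniec, *Spectral methods of automorphic forms*, §2.5 (2.25) (Weil's bound; tree
  `weil_kloosterman_bound_prime_holds`). [KuniskyYu2022] Prop. 4.11 (tree
  `sum_quadraticChar_mul_sub_mul_stdAddChar`). [MontgomeryVaughan2007] Thm 9.6 (CRT for `e(·/q)`).
-/

noncomputable section

open Finset DirichletCharacter

namespace Literature.NumberTheory.LFunctions.BondarenkoHeap2026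

/-- **Multiplicativity of the twisted complete sums** `S_q(k, r; c) = Σ_{a mod q} χ(a)χ(ak + r) e(−ac/q)`
across coprime moduli `q = q₁q₂` ("by the Chinese remainder theorem … we are left with complete sums
modulo prime powers", §4 p. 11, TeX l.532–540): with `χ = χ₁χ₂` (CRT components) and
`e(x/(q₁q₂)) = e(q̄₂u/q₁) e(q̄₁v/q₂)`,
`S_q(k,r;c) = S_{q₁}(k,r; c q̄₂) · S_{q₂}(k,r; c q̄₁)`.
[cite: BondarenkoHeap2026, §4 proof of Lemma 4 (CRT step), p. 11] -/
theorem twistedShiftSum_eq_mul_of_coprime {a b : ℕ} [NeZero a] [NeZero b] (h : a.Coprime b)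
    (χ : DirichletCharacter ℂ (a * b)) (k r : ℤ) (c : ZMod (a * b)) :
    twistedShiftSum χ k r c =
      twistedShiftSum (crtFst h χ) k r ((ZMod.cast c : ZMod a) * (b : ZMod a)⁻¹) *
        twistedShiftSum (crtSnd h χ) k r ((ZMod.cast c : ZMod b) * (a : ZMod b)⁻¹) := by
  set e := ZMod.chineseRemainder h with he
  simp only [twistedShiftSum]
  have step1 : ∑ x : ZMod (a * b), χ x * χ (x * k + r) * (ZMod.stdAddChar (-(x * c)) : ℂ) =
      ∑ p : ZMod a × ZMod b, χ (e.symm p) * χ (e.symm p * k + r) *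
        (ZMod.stdAddChar (-(e.symm p * c)) : ℂ) := by
    refine Fintype.sum_equiv e.toEquiv _ _ fun m => ?_
    simp only [RingEquiv.toEquiv_eq_coe, EquivLike.coe_coe, RingEquiv.symm_apply_apply]
  rw [step1, Fintype.sum_prod_type, Finset.sum_mul_sum]
  refine Finset.sum_congr rfl fun u _ => Finset.sum_congr rfl fun v _ => ?_
  have hk : (k : ZMod (a * b)) = e.symm ((k : ZMod a), (k : ZMod b)) := by
    have h0 : (k : ZMod (a * b)) =
        e.symm ((ZMod.cast (k : ZMod (a * b)) : ZMod a), (ZMod.cast (k : ZMod (a * b)) : ZMod b)) := by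
      rw [← PrimitiveQuadratic.chineseRemainder_apply h (k : ZMod (a * b)), RingEquiv.symm_apply_apply]
    rwa [ZMod.cast_intCast (dvd_mul_right a b), ZMod.cast_intCast (dvd_mul_left b a)] at h0
  have hr : (r : ZMod (a * b)) = e.symm ((r : ZMod a), (r : ZMod b)) := by
    have h0 : (r : ZMod (a * b)) =
        e.symm ((ZMod.cast (r : ZMod (a * b)) : ZMod a), (ZMod.cast (r : ZMod (a * b)) : ZMod b)) := by
      rw [← PrimitiveQuadratic.chineseRemainder_apply h (r : ZMod (a * b)), RingEquiv.symm_apply_apply]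
    rwa [ZMod.cast_intCast (dvd_mul_right a b), ZMod.cast_intCast (dvd_mul_left b a)] at h0
  have hc : c = e.symm ((ZMod.cast c : ZMod a), (ZMod.cast c : ZMod b)) := by
    rw [← PrimitiveQuadratic.chineseRemainder_apply h c, RingEquiv.symm_apply_apply]
  have harg : e.symm (u, v) * k + r = e.symm (u * k + r, v * k + r) := by
    conv_lhs => rw [hk, hr]
    rw [← map_mul, ← map_add, Prod.mk_mul_mk, Prod.mk_add_mk]
  have hneg : -(e.symm (u, v) * c) = e.symm (-(u * ZMod.cast c), -(v * ZMod.cast c)) := by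
    conv_lhs => rw [hc]
    rw [← map_mul, Prod.mk_mul_mk, ← map_neg, Prod.neg_mk]
  rw [harg, hneg, apply_symm_eq_crtFst_mul_crtSnd, apply_symm_eq_crtFst_mul_crtSnd,
    PrimitiveQuadratic.stdAddChar_chineseRemainder_symm]
  have e1 : -(u * (ZMod.cast c : ZMod a)) * (b : ZMod a)⁻¹ = -(u * ((ZMod.cast c : ZMod a) * (b : ZMod a)⁻¹)) := by ring
  have e2 : -(v * (ZMod.cast c : ZMod b)) * (a : ZMod b)⁻¹ = -(v * ((ZMod.cast c : ZMod b) * (a : ZMod b)⁻¹)) := by ring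
  rw [e1, e2]
  ring

/-! ### The local sums at an odd prime -/

section LocalOddPrime

variable {p : ℕ} [hp : Fact p.Prime]

/-- A quadratic Dirichlet character `χ ≠ 1` modulo an odd prime is the Legendre symbol:
`χ(x) = (x/p)`. [folklore] -/
private theorem apply_eq_quadraticChar (hp2 : p ≠ 2) {χ : DirichletCharacter ℂ p}
    (hχ : χ.IsQuadratic) (hχ1 : χ ≠ 1) (x : ZMod p) :
    χ x = (quadraticChar (ZMod p) x : ℂ) := by
  rw [PrimitiveQuadratic.eq_quadraticChar_of_isQuadratic hp2 hχ hχ1, MulChar.ringHomComp_apply]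
  simp

/-- **Case `p ∣ k`**: `S_p(k, r; c) = χ(r) Σ_a χ(a) e(−ac/p)`, so `S_p = 0` if `c = 0` (as `χ ≠ 1`)
and `|S_p| ≤ √p` otherwise (a Gauss sum). [cite: BondarenkoHeap2026, §4 (14) (local evaluation)] -/
theorem norm_twistedShiftSum_prime_of_dvd {χ : DirichletCharacter ℂ p}
    (hχp : χ.IsPrimitive) (hχ1 : χ ≠ 1) {k : ℤ} (hk : (k : ZMod p) = 0) (r : ℤ) (c : ZMod p) :
    ‖twistedShiftSum χ k r c‖ ≤ if c = 0 then 0 else Real.sqrt p := by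
  have hS : twistedShiftSum χ k r c = χ (r : ZMod p) * ∑ a : ZMod p, χ a * (ZMod.stdAddChar (-(a * c)) : ℂ) := by
    rw [twistedShiftSum, Finset.mul_sum]
    refine Finset.sum_congr rfl fun a _ => ?_
    rw [hk, mul_zero, zero_add]; ring
  rw [hS]
  split_ifs with hc
  · subst hc
    simp only [mul_zero, neg_zero, AddChar.map_zero_eq_one, mul_one]
    rw [MulChar.sum_eq_zero_of_ne_one hχ1, mul_zero, norm_zero]
  · -- a Gauss sum against the primitive character `e(−c·/p)`
    have hunit : IsUnit (-c) := isUnit_iff_ne_zero.mpr (neg_ne_zero.mpr hc)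
    have hG : ∑ a : ZMod p, χ a * (ZMod.stdAddChar (-(a * c)) : ℂ) =
        gaussSum χ (ZMod.stdAddChar.mulShift (hunit.unit : ZMod p)) := by
      rw [gaussSum]
      refine Finset.sum_congr rfl fun a _ => ?_
      rw [AddChar.mulShift_apply, IsUnit.unit_spec]
      congr 2; ring
    rw [hG, gaussSum_mulShift_eq, norm_mul, norm_mul]
    have h1 : ‖χ (r : ZMod p)‖ ≤ 1 := χ.norm_le_one _
    have h2 : ‖χ⁻¹ (hunit.unit : ZMod p)‖ ≤ 1 := χ⁻¹.norm_le_one _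
    have h3 : ‖gaussSum χ ZMod.stdAddChar‖ = Real.sqrt p := by
      have := Sieve.LargeSieve.norm_gaussSum_sq hχp
      rw [← Real.sqrt_sq (norm_nonneg _), this]
    rw [h3]
    calc ‖χ (r : ZMod p)‖ * (‖χ⁻¹ (hunit.unit : ZMod p)‖ * Real.sqrt p) ≤ 1 * (1 * Real.sqrt p) := by
          gcongr
      _ = Real.sqrt p := by ring

/-- **Case `p ∤ k`**: `S_p(k, r; c) = χ(k) Σ_a χ(a(a − t)) e(−ac/p)` with `t = −r k̄`.
[cite: BondarenkoHeap2026, §4 (14) (local evaluation)] -/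
theorem twistedShiftSum_prime_eq_of_not_dvd {χ : DirichletCharacter ℂ p} {k : ℤ}
    (hk : (k : ZMod p) ≠ 0) (r : ℤ) (c : ZMod p) :
    twistedShiftSum χ k r c = χ (k : ZMod p) *
      ∑ a : ZMod p, χ (a * (a - (-(r : ZMod p) * (k : ZMod p)⁻¹))) *
        (ZMod.stdAddChar (-(a * c)) : ℂ) := by
  rw [twistedShiftSum, Finset.mul_sum]
  refine Finset.sum_congr rfl fun a _ => ?_
  have e : a * (k : ZMod p) + (r : ZMod p) = (k : ZMod p) * (a - (-(r : ZMod p) * (k : ZMod p)⁻¹)) := by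
    field_simp
    ring
  rw [e, map_mul, map_mul]
  ring

/-- **Case `p ∤ k`, `p ∣ r`**: `Σ_a χ(a²) e(−ac/p) = p·1_{c=0} − 1`, so `|S_p| ≤ p` if `c = 0` and
`|S_p| ≤ 1` otherwise. [cite: BondarenkoHeap2026, §4 (14) (local evaluation)] -/
theorem norm_twistedShiftSum_prime_of_dvd_r {χ : DirichletCharacter ℂ p}
    (hχ : χ.IsQuadratic) {k : ℤ} (hk : (k : ZMod p) ≠ 0) {r : ℤ}
    (hr : (r : ZMod p) = 0) (c : ZMod p) :
    ‖twistedShiftSum χ k r c‖ ≤ if c = 0 then (p : ℝ) else 1 := by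
  rw [twistedShiftSum_prime_eq_of_not_dvd hk, hr]
  simp only [neg_zero, zero_mul, sub_zero]
  -- `χ(a²) = 1` for `a ≠ 0`, `= 0` for `a = 0`
  have hsq : ∀ a : ZMod p, χ (a * a) = if a = 0 then 0 else 1 := by
    intro a
    split_ifs with ha
    · rw [ha, mul_zero, χ.map_zero]
    · rw [map_mul, ← sq, ← MulChar.pow_apply' χ two_ne_zero, hχ.sq_eq_one,
        MulChar.one_apply (isUnit_iff_ne_zero.mpr ha)]
  simp_rw [hsq]
  have hsum : ∑ a : ZMod p, (if a = 0 then (0 : ℂ) else 1) * (ZMod.stdAddChar (-(a * c)) : ℂ) =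
      (∑ a : ZMod p, (ZMod.stdAddChar (-(a * c)) : ℂ)) - 1 := by
    have h1 : ∀ a : ZMod p, (if a = 0 then (0 : ℂ) else 1) * (ZMod.stdAddChar (-(a * c)) : ℂ) =
        (ZMod.stdAddChar (-(a * c)) : ℂ) - (if a = 0 then (ZMod.stdAddChar (-(a * c)) : ℂ) else 0) := by
      intro a; split_ifs <;> ring
    rw [Finset.sum_congr rfl (fun a _ => h1 a), Finset.sum_sub_distrib, Finset.sum_ite_eq']
    simp
  rw [hsum]
  have hadd : ∑ a : ZMod p, (ZMod.stdAddChar (-(a * c)) : ℂ) = if c = 0 then (p : ℂ) else 0 := by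
    have h := AddChar.sum_mulShift (-c) (ZMod.isPrimitive_stdAddChar p)
    have h' : ∑ a : ZMod p, (ZMod.stdAddChar (-(a * c)) : ℂ) = ∑ x : ZMod p, (ZMod.stdAddChar (x * -c) : ℂ) :=
      Finset.sum_congr rfl fun a _ => by congr 1; ring
    rw [h', h, ZMod.card]
    simp
  rw [hadd, norm_mul]
  have h1 : ‖χ (k : ZMod p)‖ ≤ 1 := χ.norm_le_one _
  split_ifs with hc
  · have : ‖(p : ℂ) - 1‖ ≤ p := by
      have hp1 : (1 : ℝ) ≤ p := by exact_mod_cast hp.out.one_lt.le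
      rw [show (p : ℂ) - 1 = ((p - 1 : ℝ) : ℂ) by push_cast; ring, Complex.norm_real,
        Real.norm_eq_abs, abs_of_nonneg (by linarith)]
      linarith
    calc ‖χ (k : ZMod p)‖ * ‖(p : ℂ) - 1‖ ≤ 1 * p := by gcongr
      _ = p := one_mul _
  · simp only [zero_sub, norm_neg, norm_one]
    calc ‖χ (k : ZMod p)‖ * 1 ≤ 1 * 1 := by gcongr
      _ = 1 := one_mul _

/-- **Case `p ∤ kr`**: `Σ_a χ(a(a−t)) e(−ac/p)` (`t ≠ 0`) is `−1` for `c = 0` (Jacobsthal) and a unimodular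
multiple of a Kloosterman sum `K(1, (ct/4)²; p)` otherwise (tree:
`sum_quadraticChar_mul_sub_mul_stdAddChar`), so `|S_p| ≤ 2√p` by Weil's bound (tree:
`weil_kloosterman_bound_prime_holds`). [cite: BondarenkoHeap2026, §4 (14) ("Gauss sums, (r, Q) = 1: square-root cancellation")] -/
theorem norm_twistedShiftSum_prime_of_not_dvd (hp2 : p ≠ 2) {χ : DirichletCharacter ℂ p}
    (hχ : χ.IsQuadratic) (hχ1 : χ ≠ 1) {k : ℤ} (hk : (k : ZMod p) ≠ 0) {r : ℤ}
    (hr : (r : ZMod p) ≠ 0) (c : ZMod p) :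
    ‖twistedShiftSum χ k r c‖ ≤ if c = 0 then (1 : ℝ) else 2 * Real.sqrt p := by
  set t : ZMod p := -(r : ZMod p) * (k : ZMod p)⁻¹ with ht
  have ht0 : t ≠ 0 := by
    rw [ht]; exact mul_ne_zero (neg_ne_zero.mpr hr) (inv_ne_zero hk)
  rw [twistedShiftSum_prime_eq_of_not_dvd hk]
  have hleg : ∀ a : ZMod p, χ (a * (a - t)) = (quadraticChar (ZMod p) (a * (a - t)) : ℂ) :=
    fun a => apply_eq_quadraticChar hp2 hχ hχ1 _
  have hinner : ∑ a : ZMod p, χ (a * (a - t)) * (ZMod.stdAddChar (-(a * c)) : ℂ) =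
      ∑ y : ZMod p, (quadraticChar (ZMod p) (y * (y - t)) : ℂ) * ZMod.stdAddChar ((-c) * y) := by
    refine Finset.sum_congr rfl fun a _ => ?_
    rw [hleg]; congr 2; ring
  rw [← ht, hinner, norm_mul]
  have h1 : ‖χ (k : ZMod p)‖ ≤ 1 := χ.norm_le_one _
  split_ifs with hc
  · subst hc
    simp only [neg_zero, zero_mul, AddChar.map_zero_eq_one, mul_one]
    rw [sum_quadraticChar_mul_sub_eq_neg_one hp2 ht0, norm_neg, norm_one]
    calc ‖χ (k : ZMod p)‖ * 1 ≤ 1 * 1 := by gcongr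
      _ = 1 := one_mul _
  · rw [sum_quadraticChar_mul_sub_mul_stdAddChar hp2 ht0 (-c), norm_mul,
      AddChar.norm_apply, one_mul]
    have hn : ((-c) * t / 4) ^ 2 ≠ 0 := by
      have h4 : (4 : ZMod p) ≠ 0 := by
        have h2 : (2 : ZMod p) ≠ 0 := by
          intro h
          have h2' : ((2 : ℕ) : ZMod p) = 0 := by exact_mod_cast h
          rw [ZMod.natCast_eq_zero_iff] at h2'
          exact hp2 ((Nat.prime_dvd_prime_iff_eq hp.out Nat.prime_two).mp h2')
        have : (4 : ZMod p) = 2 * 2 := by norm_num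
        rw [this]; exact mul_ne_zero h2 h2
      exact pow_ne_zero _ (div_ne_zero (mul_ne_zero (neg_ne_zero.mpr hc) ht0) h4)
    have hW := weil_kloosterman_bound_prime_holds p 1 (((-c) * t / 4) ^ 2) one_ne_zero hn
    calc ‖χ (k : ZMod p)‖ * ‖kloostermanSum p 1 (((-c) * t / 4) ^ 2)‖ ≤ 1 * (2 * Real.sqrt p) := by
          gcongr
      _ = 2 * Real.sqrt p := one_mul _

end LocalOddPrime

end Literature.NumberTheory.LFunctions.BondarenkoHeap2026
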